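/-
Copyright (c) 2026. All rights reserved.
Released under Apache 2.0 license as described in the file LICENSE.
Authors: abc-iut cell, seat abc-iut-L4-t14 (gen 3; the UNIFORMISED objects `X̃/Λ` and morphisms
`[x] ↦ [g • x]` of the geometric `EA` of [AbsTopIII] Def 4.1 / Prop 4.2 (i), realising the group model
`Loc(N, Γ)` inside `HolRS`).
-/
import Literature.AnabelianGeometry.AbsoluteAnabelian.ArchimedeanHolFieldFunctorGeometric
import Literature.AnabelianGeometry.AbsoluteAnabelian.LocCategoryGroupModel
import Literature.Geometry.Manifold.QuotientConjugationMap
import HarnessLib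

/-!
# Uniformised Riemann surfaces `X̃/Λ` and the maps `[x] ↦ [g • x]` as objects and morphisms of `HolRS`

S. Mochizuki, *Topics in absolute anabelian geometry III*, Def 4.1 (i)/(iii) pp. 101–103 (connected
Aut-holomorphic orbispaces, finite étale morphisms — abc-iut-L4-t14's `HolRS`, the holomorphic
Riemann-surface part of the geometric `EA`) and the proof of Prop 4.2 (i) p. 106 l. 14–19 ("the full
subcategory of `EA` consisting of objects that map to `X` may … be identified with the category of finite
étale R-localizations `Loc_R(X)`", kurims manuscript `paper:url-5493eb38cbb7`; bib key
`MochizukiAbsTopIII2015`); A. Hatcher, *Algebraic Topology*, §1.3 Exercise 24 (`X → X/H → X/G`).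

Let `X̃` be a connected Riemann surface (`X̃ : HolRS`) with a group `N` acting by biholomorphisms
(`MulAction N X̃`, `ContinuousConstSMul`, every `g • ·` of class `C^ω`), and let subgroups `K, L ≤ N` act
freely and properly discontinuously.  This file constructs (MODEL ≠ reconstruction; uniformisation
itself — that every object of print's `EA` is such a quotient of `X̃ = ℍ` — is NOT proved here):

* (topology, previous file `Literature/Geometry/Manifold/QuotientConjugationMap.lean`:
  `QuotientManifold.quotientMap g K L h : X̃/K → X̃/L`, `[x] ↦ [g • x]`, is a COVERING MAP with finite
  fibres when `[L : gKg⁻¹] < ∞` — Hatcher §1.3 Ex. 24 twisted by `g`);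
* `HolRS.ofQuotient X̃ K hN : HolRS` — `X̃/K` as a connected Riemann surface (Mathlib
  `MulAction.instChartedSpaceQuotient` + the tree's `QuotientManifold.isManifold`);
* `HolRS.quotientHom` — `[x] ↦ [g • x]` as a MORPHISM `X̃/K ⟶ X̃/L` of `HolRS` (holomorphic by descent,
  `QuotientMaps.contMDiff_comp_mk_iff`; finite étale by the above), with `quotientHom_toFun_mk`;
* `HolRS.LocObj.toHolRS` — for `Γ ≤ N` acting freely and properly discontinuously, the FUNCTOR
  `Loc(N, Γ) ⥤ HolRS`, `Λ ↦ X̃/Λ`, `[g] ↦ ([x] ↦ [g • x])`, from abc-iut-L4-t14's group model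
  (`LocCategoryGroupModel.lean`, p432943), under the finite-fibre hypothesis `hfin` («`[Λ₂ : gΛ₁g⁻¹] < ∞`
  for every representative», automatic for lattices of finite covolume — a HYPOTHESIS here).

These are the uniformised objects «`ℍ/Λ`» and morphisms «`z ↦ g z`» of print's `Loc_R(X)`; FULLNESS
(every finite étale map `ℍ/Λ₁ → ℍ/Λ₂` is of this form) is abc-iut-w5-d208's «R1.2-UNIF-LIFT» and
FAITHFULNESS (needs the identity theorem for the `N`-action) are not claimed here.  Campaign-L support
(GAP row G-L4t14-R1, junction J1); refereed pre-IUT material; nothing here bears on [IUTchIII]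
Cor. 3.12; typed ≠ proved; model ≠ reconstruction.
-/

set_option autoImplicit false

noncomputable section

open scoped Manifold ContDiff Topology
open _root_.MulAction _root_.Function _root_.Set
open Literature.Geometry.Manifold

namespace Literature.AnabelianGeometry.AbsoluteAnabelian

namespace HolRS

open Literature.Geometry.Manifold.QuotientManifold (quotientMap quotientMap_mk conjSubgroup
  isCoveringMap_quotientMap finite_preimage_quotientMap)

/-! ### `X̃/K` as an object of `HolRS`, `[x] ↦ [g • x]` as a morphism -/

section Objects

variable (X : HolRS) {N : Type} [Group N] [MulAction N X.carrier] [ContinuousConstSMul N X.carrier]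

/-- **The uniformised object `X̃/K`** of `HolRS`: the orbit space of a subgroup `K ≤ N` acting freely and
properly discontinuously on the connected Riemann surface `X̃`, `N` acting by biholomorphisms
(`hN`).  Hausdorff (Mathlib), connected (image of `X̃`), charted (`MulAction.instChartedSpaceQuotient`)
with holomorphic transitions (`QuotientManifold.isManifold`). [cite: MochizukiAbsTopIII2015, Definition 4.1 (i) p.101] -/
def ofQuotient (K : Subgroup N) [ProperlyDiscontinuousSMul K X.carrier] [IsCancelSMul K X.carrier]
    (hN : ∀ g : N, ContMDiff 𝓘(ℂ, ℂ) 𝓘(ℂ, ℂ) ω (fun x : X.carrier => g • x)) : HolRS :=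
  haveI : LocallyCompactSpace X.carrier := ChartedSpace.locallyCompactSpace ℂ X.carrier
  haveI : IsManifold 𝓘(ℂ, ℂ) ω (orbitRel.Quotient K X.carrier) :=
    QuotientManifold.isManifold (G := K) (fun k => hN (k : N))
  ⟨orbitRel.Quotient K X.carrier⟩

/-- The carrier of `X̃/K` is the orbit space. [cite: MochizukiAbsTopIII2015, Definition 4.1 (i) p.101] -/
theorem ofQuotient_carrier (K : Subgroup N) [ProperlyDiscontinuousSMul K X.carrier]
    [IsCancelSMul K X.carrier]
    (hN : ∀ g : N, ContMDiff 𝓘(ℂ, ℂ) 𝓘(ℂ, ℂ) ω (fun x : X.carrier => g • x)) :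
    (ofQuotient X K hN).carrier = orbitRel.Quotient K X.carrier := rfl

/-- **The morphism `[x] ↦ [g • x] : X̃/K ⟶ X̃/L` of `HolRS`** for `g K g⁻¹ ≤ L` of finite index in `L`:
holomorphic by descent along `X̃ → X̃/K` (`QuotientMaps.contMDiff_comp_mk_iff`), finite étale by
`isCoveringMap_quotientMap` / `finite_preimage_quotientMap`. [cite: MochizukiAbsTopIII2015, Definition 4.1 (iii) p.103] -/
def quotientHom (K L : Subgroup N) [ProperlyDiscontinuousSMul K X.carrier] [IsCancelSMul K X.carrier]
    [ProperlyDiscontinuousSMul L X.carrier] [IsCancelSMul L X.carrier]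
    (hN : ∀ g : N, ContMDiff 𝓘(ℂ, ℂ) 𝓘(ℂ, ℂ) ω (fun x : X.carrier => g • x))
    (g : N) (h : ∀ x ∈ K, g * x * g⁻¹ ∈ L) [((conjSubgroup g K).subgroupOf L).FiniteIndex] :
    ofQuotient X K hN ⟶ ofQuotient X L hN :=
  haveI : LocallyCompactSpace X.carrier := ChartedSpace.locallyCompactSpace ℂ X.carrier
  { toFun := quotientMap g K L h
    mdifferentiable := by
      have hc : ContMDiff 𝓘(ℂ, ℂ) 𝓘(ℂ, ℂ) ω
          (quotientMap (T := X.carrier) g K L h ∘ QuotientManifold.mk (G := K)) := by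
        have : quotientMap (T := X.carrier) g K L h ∘ QuotientManifold.mk (G := K) =
            QuotientManifold.mk (G := L) ∘ fun x : X.carrier => g • x := by
          funext x; rfl
        rw [this]
        exact (QuotientManifold.contMDiff_mk (G := L) fun l => hN (l : N)).comp (hN g)
      exact ((QuotientManifold.contMDiff_comp_mk_iff (G := K) (fun k => hN (k : N))).mp hc).mdifferentiable
        (by decide)
    isFiniteEtale :=
      { isCoveringMap := isCoveringMap_quotientMap g K L h
        finite_fibre := finite_preimage_quotientMap g K L h } }

/-- The underlying map of `quotientHom` on classes. [cite: MochizukiAbsTopIII2015, Definition 4.1 (iii) p.103] -/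
theorem quotientHom_toFun_mk (K L : Subgroup N) [ProperlyDiscontinuousSMul K X.carrier]
    [IsCancelSMul K X.carrier] [ProperlyDiscontinuousSMul L X.carrier] [IsCancelSMul L X.carrier]
    (hN : ∀ g : N, ContMDiff 𝓘(ℂ, ℂ) 𝓘(ℂ, ℂ) ω (fun x : X.carrier => g • x))
    (g : N) (h : ∀ x ∈ K, g * x * g⁻¹ ∈ L) [((conjSubgroup g K).subgroupOf L).FiniteIndex]
    (x : X.carrier) :
    (quotientHom X K L hN g h).toFun (Quotient.mk _ x) = Quotient.mk _ (g • x) := rfl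

end Objects

/-! ### The functor `Loc(N, Γ) ⥤ HolRS` -/

section Functor

open _root_.CategoryTheory

variable (X : HolRS) {N : Type} [Group N] [MulAction N X.carrier] [ContinuousConstSMul N X.carrier]
  (hN : ∀ g : N, ContMDiff 𝓘(ℂ, ℂ) 𝓘(ℂ, ℂ) ω (fun x : X.carrier => g • x))
  (Γ : Subgroup N) [ProperlyDiscontinuousSMul Γ X.carrier] [IsCancelSMul Γ X.carrier]

omit [ContinuousConstSMul N X.carrier] [ProperlyDiscontinuousSMul Γ X.carrier] in
/-- A subgroup of a freely acting subgroup acts freely. [cite: MochizukiAbsTopIII2015, Proposition 4.2 (i) proof p.106] -/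
theorem isCancelSMul_of_le {Λ : Subgroup N} (hΛ : Λ ≤ Γ) : IsCancelSMul Λ X.carrier where
  left_cancel' a b c h := by simpa using congrArg (fun y => a⁻¹ • y) h
  right_cancel' a b c h := by
    have h' : (⟨(a : N), hΛ a.2⟩ : Γ) = ⟨(b : N), hΛ b.2⟩ :=
      IsCancelSMul.right_cancel (⟨(a : N), hΛ a.2⟩ : Γ) ⟨(b : N), hΛ b.2⟩ c h
    exact Subtype.ext (by simpa using congrArg Subtype.val h')

/-- The object `X̃/Λ` of `HolRS` attached to an object `Λ` of `Loc(N, Γ)` (a finite-index `Λ ≤ Γ`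
acts freely and properly discontinuously because `Γ` does). [cite: MochizukiAbsTopIII2015, Proposition 4.2 (i) proof p.106] -/
def LocObj.toHolRSObj (Λ : LocObj Γ) : HolRS :=
  haveI : ProperlyDiscontinuousSMul Λ.toSubgroup X.carrier :=
    Subgroup.properlyDiscontinuousSMul_of_le ‹ProperlyDiscontinuousSMul Γ X.carrier› Λ.le
  haveI : IsCancelSMul Λ.toSubgroup X.carrier := isCancelSMul_of_le X Γ Λ.le
  ofQuotient X Λ.toSubgroup hN

/-- The morphism of `HolRS` attached to a representative `g` of a morphism `Λ₁ → Λ₂` of `Loc(N, Γ)`,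
under the finite-fibre hypothesis. [cite: MochizukiAbsTopIII2015, Proposition 4.2 (i) proof p.106] -/
def LocObj.toHolRSMapRep
    (hfin : ∀ (g : N) (Λ₁ Λ₂ : LocObj Γ), (∀ x ∈ Λ₁.toSubgroup, g * x * g⁻¹ ∈ Λ₂.toSubgroup) →
      ((conjSubgroup g Λ₁.toSubgroup).subgroupOf Λ₂.toSubgroup).FiniteIndex)
    {Λ₁ Λ₂ : LocObj Γ} (g : LocObj.HomRep Λ₁ Λ₂) :
    LocObj.toHolRSObj X hN Γ Λ₁ ⟶ LocObj.toHolRSObj X hN Γ Λ₂ :=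
  haveI : ProperlyDiscontinuousSMul Λ₁.toSubgroup X.carrier :=
    Subgroup.properlyDiscontinuousSMul_of_le ‹ProperlyDiscontinuousSMul Γ X.carrier› Λ₁.le
  haveI : IsCancelSMul Λ₁.toSubgroup X.carrier := isCancelSMul_of_le X Γ Λ₁.le
  haveI : ProperlyDiscontinuousSMul Λ₂.toSubgroup X.carrier :=
    Subgroup.properlyDiscontinuousSMul_of_le ‹ProperlyDiscontinuousSMul Γ X.carrier› Λ₂.le
  haveI : IsCancelSMul Λ₂.toSubgroup X.carrier := isCancelSMul_of_le X Γ Λ₂.le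
  haveI := hfin g.1 Λ₁ Λ₂ g.2
  quotientHom X Λ₁.toSubgroup Λ₂.toSubgroup hN g.1 g.2

/-- Its underlying map on classes. [cite: MochizukiAbsTopIII2015, Proposition 4.2 (i) proof p.106] -/
theorem LocObj.toHolRSMapRep_toFun_mk
    (hfin : ∀ (g : N) (Λ₁ Λ₂ : LocObj Γ), (∀ x ∈ Λ₁.toSubgroup, g * x * g⁻¹ ∈ Λ₂.toSubgroup) →
      ((conjSubgroup g Λ₁.toSubgroup).subgroupOf Λ₂.toSubgroup).FiniteIndex)
    {Λ₁ Λ₂ : LocObj Γ} (g : LocObj.HomRep Λ₁ Λ₂) (x : X.carrier) :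
    (LocObj.toHolRSMapRep X hN Γ hfin g).toFun (Quotient.mk _ x) = Quotient.mk _ (g.1 • x) := rfl

/-- **The functor `Loc(N, Γ) ⥤ HolRS`**, `Λ ↦ X̃/Λ`, `[g] ↦ ([x] ↦ [g • x])` — the uniformised
realisation of print's `Loc_R(X)` inside the geometric `EA` (objects «`ℍ/Λ`», morphisms «`z ↦ g z`»),
under the finite-fibre hypothesis `hfin`.  Well defined on `Λ₂`-cosets of representatives
(`quotientMap_eq_of_mul_mem`), functorial by `[1 • x] = [x]` and `[g' • g • x] = [(g' g) • x]`.
[cite: MochizukiAbsTopIII2015, Proposition 4.2 (i) proof p.106] -/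
def LocObj.toHolRS
    (hfin : ∀ (g : N) (Λ₁ Λ₂ : LocObj Γ), (∀ x ∈ Λ₁.toSubgroup, g * x * g⁻¹ ∈ Λ₂.toSubgroup) →
      ((conjSubgroup g Λ₁.toSubgroup).subgroupOf Λ₂.toSubgroup).FiniteIndex) :
    LocObj Γ ⥤ HolRS where
  obj Λ := LocObj.toHolRSObj X hN Γ Λ
  map {Λ₁ Λ₂} f :=
    Quotient.liftOn f (fun g => LocObj.toHolRSMapRep X hN Γ hfin g) fun a b hab => by
      apply hom_ext
      funext q
      induction q using Quotient.inductionOn with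
      | h x =>
        rw [LocObj.toHolRSMapRep_toFun_mk, LocObj.toHolRSMapRep_toFun_mk]
        refine Quotient.sound ⟨⟨b.1 * a.1⁻¹, hab⟩⁻¹, ?_⟩
        change (b.1 * a.1⁻¹)⁻¹ • b.1 • x = a.1 • x
        rw [smul_smul, mul_inv_rev, inv_inv, inv_mul_cancel_right]
  map_id Λ := by
    apply hom_ext
    funext q
    change (LocObj.toHolRSMapRep X hN Γ hfin (LocObj.HomRep.id Λ)).toFun q = q
    induction q using Quotient.inductionOn with
    | h x =>
      rw [LocObj.toHolRSMapRep_toFun_mk]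
      exact congrArg _ (one_smul N x)
  map_comp {Λ₁ Λ₂ Λ₃} f f' := by
    induction f using Quotient.inductionOn with
    | h a =>
    induction f' using Quotient.inductionOn with
    | h b =>
      apply hom_ext
      funext q
      change (LocObj.toHolRSMapRep X hN Γ hfin (LocObj.HomRep.comp a b)).toFun q =
        (LocObj.toHolRSMapRep X hN Γ hfin b).toFun ((LocObj.toHolRSMapRep X hN Γ hfin a).toFun q)
      induction q using Quotient.inductionOn with
      | h x =>
        rw [LocObj.toHolRSMapRep_toFun_mk, LocObj.toHolRSMapRep_toFun_mk,
          LocObj.toHolRSMapRep_toFun_mk]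
        exact congrArg _ (mul_smul b.1 a.1 x)

/-- On objects the functor is `Λ ↦ X̃/Λ`. [cite: MochizukiAbsTopIII2015, Proposition 4.2 (i) proof p.106] -/
theorem LocObj.toHolRS_obj_carrier
    (hfin : ∀ (g : N) (Λ₁ Λ₂ : LocObj Γ), (∀ x ∈ Λ₁.toSubgroup, g * x * g⁻¹ ∈ Λ₂.toSubgroup) →
      ((conjSubgroup g Λ₁.toSubgroup).subgroupOf Λ₂.toSubgroup).FiniteIndex) (Λ : LocObj Γ) :
    ((LocObj.toHolRS X hN Γ hfin).obj Λ).carrier = orbitRel.Quotient Λ.toSubgroup X.carrier := rfl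

/-- On morphisms the functor sends `[g]` to `[x] ↦ [g • x]`. [cite: MochizukiAbsTopIII2015, Proposition 4.2 (i) proof p.106] -/
theorem LocObj.toHolRS_map_homMk_toFun_mk
    (hfin : ∀ (g : N) (Λ₁ Λ₂ : LocObj Γ), (∀ x ∈ Λ₁.toSubgroup, g * x * g⁻¹ ∈ Λ₂.toSubgroup) →
      ((conjSubgroup g Λ₁.toSubgroup).subgroupOf Λ₂.toSubgroup).FiniteIndex)
    {Λ₁ Λ₂ : LocObj Γ} (g : N) (hg : ∀ x ∈ Λ₁.toSubgroup, g * x * g⁻¹ ∈ Λ₂.toSubgroup)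
    (x : X.carrier) :
    ((LocObj.toHolRS X hN Γ hfin).map (LocObj.homMk g hg)).toFun (Quotient.mk _ x) =
      Quotient.mk _ (g • x) := rfl

end Functor

end HolRS

end Literature.AnabelianGeometry.AbsoluteAnabelian

end
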